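import Summits.ABC.ABC.Theses.IsogenyGlueCongruence
import Summits.ABC.ABC.Theorems.SharpDegreeOfPolyDegree.Negative.ExponentFloor
import Literature.Barriers.ABC.SzpiroEpsilonCannotBeDroppedHolds

-- `Summit.ABC.ABC.…`: summit and sub-problem share the name `ABC` (single-conjunct summit, D-0017).
set_option linter.dupNamespace false

/-!
# `SharpDegreeOfPolyHeight` (stmt-ABC-16009) — negative lemma: the floor of its hypothesis

`R' := SharpDegreeOfPolyHeight = (H → X)` with `X = SemistableDegreeConjecture` and
`H = ∃ σ C, ∀ W` (semistable globally minimal elliptic curve over `ℚ`),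
`max(|Δ_W|, |c₄(W)|³) ≤ C · N_W^σ` — the polynomial height (Szpiro) conjecture for semistable curves.

Refuter crux-attack (degenerate / extreme parameters), kernel-checked:

* `exists_curve_gt_of_le_six`, `not_polyHeightAt_of_le_six` — for every FIXED exponent `σ ≤ 6` and
  every constant `C` the `σ`-slice of `H` is FALSE: Masser's semistable curves with
  `|Δ_min| > C · N^6` (Masser 1990, proved in the tree as
  `Literature.Barriers.ABC.Masser.exists_semistable_curve_polylog_excess`), transported to a global
  minimal model (`SharpDegreeOfPolyDegree.Negative.exists_globallyMinimal_model`).  So the slices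
  `σ ≤ 6` of `R'` are vacuously true and carry no information; the content of the item is the exponent
  drop `σ > 6 ↦ 2 + ε`.
* `six_lt_of_polyHeightAt`, `pos_of_polyHeightAt` — any witness `(σ, C)` of `H` has `σ > 6` and
  `C > 0`: a proof of `R'` may assume both without loss (the degenerate parameter cases `σ ≤ 0`,
  `C ≤ 0` never occur).

Purely negative / boundary content about the HYPOTHESIS of the item; no Theses statement is asserted.
-/

noncomputable section

namespace Summit.ABC.ABC.Theorems.SharpDegreeOfPolyHeight.Negative

open Summit.ABC.ABC.Theses.IsogenyGlueCongruence
open WeierstrassCurve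

/-- **Floor of the height hypothesis, witness form.** For `σ ≤ 6` and every real `C` there is a
semistable elliptic curve over `ℚ` in global minimal form, of positive conductor, with
`C · N^σ < max(|Δ|, |c₄|³)` (indeed `< |Δ| = |Δ_min|`). [cite: Masser1990, Theorem and Lemma 1] -/
theorem exists_curve_gt_of_le_six {σ : ℝ} (hσ : σ ≤ 6) (C : ℝ) :
    ∃ W : WeierstrassCurve ℚ, W.IsElliptic ∧ W.IsGloballyMinimal ∧ W.IsSemistable ℤ ∧
      0 < W.conductorNorm ℤ ∧
      C * (W.conductorNorm ℤ : ℝ) ^ σ < ((max |W.Δ| (|W.c₄| ^ 3) : ℚ) : ℝ) := by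
  obtain ⟨W, hW, hss, hN, hlt⟩ :=
    Literature.Barriers.ABC.Masser.exists_semistable_curve_polylog_excess 0 (max C 0) 0
  haveI := hW
  obtain ⟨W₁, hE₁, hM₁, hss₁, hN₁, hΔ₁⟩ :=
    Summit.ABC.ABC.Theorems.SharpDegreeOfPolyDegree.Negative.exists_globallyMinimal_model W
  refine ⟨W₁, hE₁, hM₁, hss₁ hss, by rw [hN₁]; exact hN, ?_⟩
  rw [hN₁]
  have hN1 : (1 : ℝ) ≤ (W.conductorNorm ℤ : ℝ) := Nat.one_le_cast.mpr hN
  have hNσ : (0 : ℝ) ≤ (W.conductorNorm ℤ : ℝ) ^ σ := Real.rpow_nonneg (Nat.cast_nonneg _) σ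
  have hC0 : (0 : ℝ) ≤ max C 0 := le_max_right _ _
  have h1a : C * (W.conductorNorm ℤ : ℝ) ^ σ ≤ max C 0 * (W.conductorNorm ℤ : ℝ) ^ σ :=
    mul_le_mul_of_nonneg_right (le_max_left _ _) hNσ
  have h1b : max C 0 * (W.conductorNorm ℤ : ℝ) ^ σ ≤ max C 0 * (W.conductorNorm ℤ : ℝ) ^ (6 : ℝ) :=
    mul_le_mul_of_nonneg_left (Real.rpow_le_rpow_of_exponent_le hN1 hσ) hC0
  have h6 : (W.conductorNorm ℤ : ℝ) ^ (6 : ℝ) = (W.conductorNorm ℤ : ℝ) ^ (6 : ℕ) := by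
    norm_cast
  rw [h6] at h1b
  have h2 : max C 0 * (W.conductorNorm ℤ : ℝ) ^ (6 : ℕ) < (W.minimalDiscriminantNorm ℤ : ℝ) := by
    simpa only [Real.rpow_zero, mul_one] using hlt
  have h3 : (W.minimalDiscriminantNorm ℤ : ℝ) ≤ ((max |W₁.Δ| (|W₁.c₄| ^ 3) : ℚ) : ℝ) := by
    rw [← hΔ₁]
    exact Rat.cast_le.mpr (le_max_left _ _)
  exact lt_of_le_of_lt (h1a.trans h1b) (h2.trans_le h3)

/-- **Floor of the height hypothesis.** For no FIXED exponent `σ ≤ 6` is there a constant `C` with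
`max(|Δ_W|, |c₄(W)|³) ≤ C · N_W^σ` for every semistable elliptic `W/ℚ` in global minimal form: the
`σ ≤ 6` slices of the antecedent of `SharpDegreeOfPolyHeight` are false, so those slices of the item
hold vacuously. [cite: Masser1990, Theorem and Lemma 1] -/
theorem not_polyHeightAt_of_le_six {σ : ℝ} (hσ : σ ≤ 6) :
    ¬ ∃ C : ℝ, ∀ (W : WeierstrassCurve ℚ) [W.IsElliptic] [W.IsGloballyMinimal]
      [NeZero (W.conductorNorm ℤ)], W.IsSemistable ℤ →
        ((max |W.Δ| (|W.c₄| ^ 3) : ℚ) : ℝ) ≤ C * (W.conductorNorm ℤ : ℝ) ^ σ := by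
  rintro ⟨C, hC⟩
  obtain ⟨W, hE, hM, hss, hN, hlt⟩ := exists_curve_gt_of_le_six hσ C
  haveI := hE
  haveI := hM
  haveI : NeZero (W.conductorNorm ℤ) := ⟨hN.ne'⟩
  exact absurd (hC W hss) (not_le.mpr hlt)

/-- **Any witness of the height hypothesis has exponent `σ > 6`.** [cite: Masser1990, Theorem and Lemma 1] -/
theorem six_lt_of_polyHeightAt {σ C : ℝ}
    (h : ∀ (W : WeierstrassCurve ℚ) [W.IsElliptic] [W.IsGloballyMinimal]
      [NeZero (W.conductorNorm ℤ)], W.IsSemistable ℤ →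
        ((max |W.Δ| (|W.c₄| ^ 3) : ℚ) : ℝ) ≤ C * (W.conductorNorm ℤ : ℝ) ^ σ) : 6 < σ :=
  not_le.mp fun hσ => not_polyHeightAt_of_le_six hσ ⟨C, fun W _ _ _ hW => h W hW⟩

/-- **Any witness of the height hypothesis has constant `C > 0`** (the binder class is inhabited —
`SharpDegreeOfPolyDegree.Negative.exists_semistable_globallyMinimal` — and `Δ_W ≠ 0`). [folklore] -/
theorem pos_of_polyHeightAt {σ C : ℝ}
    (h : ∀ (W : WeierstrassCurve ℚ) [W.IsElliptic] [W.IsGloballyMinimal]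
      [NeZero (W.conductorNorm ℤ)], W.IsSemistable ℤ →
        ((max |W.Δ| (|W.c₄| ^ 3) : ℚ) : ℝ) ≤ C * (W.conductorNorm ℤ : ℝ) ^ σ) : 0 < C := by
  obtain ⟨W, hE, hM, hss, hN⟩ :=
    Summit.ABC.ABC.Theorems.SharpDegreeOfPolyDegree.Negative.exists_semistable_globallyMinimal 0
  haveI := hE
  haveI := hM
  haveI : NeZero (W.conductorNorm ℤ) := ⟨hN.ne'⟩
  have hW := h W hss
  refine not_le.mp fun hC => ?_
  have hNσ : (0 : ℝ) ≤ (W.conductorNorm ℤ : ℝ) ^ σ := Real.rpow_nonneg (Nat.cast_nonneg _) σ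
  have h0 : C * (W.conductorNorm ℤ : ℝ) ^ σ ≤ 0 := by
    have := mul_le_mul_of_nonneg_right hC hNσ
    rwa [zero_mul] at this
  have hΔ : (0 : ℝ) < ((max |W.Δ| (|W.c₄| ^ 3) : ℚ) : ℝ) := by
    have hq : (0 : ℚ) < max |W.Δ| (|W.c₄| ^ 3) :=
      (abs_pos.mpr W.isUnit_Δ.ne_zero).trans_le (le_max_left _ _)
    exact Rat.cast_pos.mpr hq
  linarith

end Summit.ABC.ABC.Theorems.SharpDegreeOfPolyHeight.Negative

end
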